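import Summits.QuantumFields.YangMills.Theorems.LuscherReductionTwistedTraceScalingBOCapProfile
import Summits.QuantumFields.YangMills.Theorems.LuscherReductionTwistedTraceScalingBOSliceCoreIndicators
import Summits.QuantumFields.YangMills.Theorems.LuscherReductionTwistedTraceScalingSlowShadow
import HarnessLib

/-!
# (C1-η) SUPPORT OF THE WINDOWED BO FUNCTION INSIDE AN AUXILIARY FAT TUBE: `boFun χ₀ Ω ≠ 0 ⇒ recordChi s'' 1 M' ≠ 0` once the slow window and the profile radius are below the tube radii
# (lane A of S-BASE, crux `TwistedTraceScaling` stmt-QuantumFields-20203, C4-CORE, the (OD) pen; hypothesis `hbo` of `…BOCentralTransferSharp.central_transfer_two_sided_chart_sharp`)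

* ★ `orthoTube_mem_fatTubeRho` — for `v ∈ capBalancedSet` with `|v_{e,c}| ≤ a ≤ 1/8` and a slow variable with `‖q(u_k) − 1‖ ≤ δu`: every link of `orthoTube u v` is within `7a + 2δu` of `1`
  (Frobenius) and `orthoDist ≤ |E|(7a + 2δu)`; so `orthoTube u v ∈ fatTubeRho δ ρ β` as soon as `|E|(7a + 2δu) < δ β` and `7a + 2δu < ρ β`;
* ★★ `boFun_support_recordChi` — `hbo`: if `χ₀ u ≠ 0 ⇒ ‖q(u_k) − 1‖ ≤ δu`, `Ω x ≠ 0 ⇒ ‖x‖ ≤ a` (e.g. the cap-restricted frozen profile of radius `a`), `a ≤ 1/8`, and the two radius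
  inequalities hold for `δ = K·β^{-s}`, `ρ = M·K·β^{-s}`, then `boFun χ₀ Ω U ≠ 0 → recordChi L s K M β U ≠ 0`.
HONEST FRAMING: support bookkeeping for a stub of a child of the CONDITIONAL route R2b1; (C1) packaging, (C4), (C5), (B-ST) OPEN; C4-CORE OPEN; not infinite volume, not a gap, not Clay.
-/

set_option autoImplicit false

noncomputable section

open MeasureTheory Real
open scoped BigOperators
open Literature.MathematicalPhysics.QuantumFieldTheory
open Literature.MathematicalPhysics.QuantumLattice

namespace Summit.QuantumFields.YangMills.Theorems.FemtoTransferGap.TwoLattice.ConstTube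

open Summit.QuantumFields.YangMills.Theorems.FemtoTransferGap
open Summit.QuantumFields.YangMills.Theorems.FemtoTransferGap.TwoLattice
open Summit.QuantumFields.YangMills.Theorems.FemtoTransferGap.TwoLattice.Avg
open Summit.QuantumFields.YangMills.Theorems.FemtoTransferGap.TwoLattice.Stiff
open Summit.QuantumFields.YangMills.Theorems.FemtoTransferGap.TwoLattice.GnChart

variable {L : ℕ} [NeZero L]

/-- ★ **Tube points with a small slow variable lie in the fat tube.**  For `v` with `‖v_e‖∞ ≤ a ≤ 1/8` and `‖q(u_k) − 1‖ ≤ δu` (`δu ≥ 0`): every link of `orthoTube u v` is within `8a + 2δu`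
of `1` in Frobenius norm, and `orbitDist (orthoTube u v) ≤ |E|(8a + 2δu)`. [folklore] -/
theorem orthoTube_near_data {u : GaugeConfig 3 1 SU2} {v : Edge 3 L → Fin 3 → ℝ} {a δu : ℝ} (ha : a ≤ 1 / 8) (hv : ∀ e, ‖v e‖ ≤ a)
    (hu : ∀ k : Fin 3, ‖su2Quat (u (0, k)) - 1‖ ≤ δu) :
    (∀ e : Edge 3 L, frobNorm (((orthoTube L u v e : SU2) : Matrix (Fin 2) (Fin 2) ℂ) - 1) ≤ 8 * a + 2 * δu) ∧
      orbitDist (orthoTube L u v) ≤ Fintype.card (Edge 3 L) * (8 * a + 2 * δu) := by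
  have hlink : ∀ e : Edge 3 L, frobNorm (((orthoTube L u v e : SU2) : Matrix (Fin 2) (Fin 2) ℂ) - 1) ≤ 8 * a + 2 * δu := fun e => by
    rw [orthoTube_apply]
    have h1 := frobNorm_mul_sub_one_le (chartSU2 (v e)) (u (0, e.2))
    have h2 : frobNorm (((chartSU2 (v e) : SU2) : Matrix (Fin 2) (Fin 2) ℂ) - 1) ≤ 4 * ‖v e‖ := frobNorm_chartSU2_sub_one_le ((hv e).trans (by linarith))
    have h3 := frobNorm_sub_one_le_two_norm (u (0, e.2))
    have h4 : 4 * ‖v e‖ ≤ 4 * a := by linarith [hv e]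
    have h5 : 2 * ‖su2Quat (u (0, e.2)) - 1‖ ≤ 2 * δu := by linarith [hu e.2]
    have ha0 : 0 ≤ a := (norm_nonneg _).trans (hv e)
    exact h1.trans (by linarith)
  refine ⟨hlink, ?_⟩
  calc orbitDist (orthoTube L u v) ≤ gaugeDist 1 (orthoTube L u v) := orbitDist_le 1 _
    _ = ∑ e : Edge 3 L, frobNorm (((orthoTube L u v e : SU2) : Matrix (Fin 2) (Fin 2) ℂ) - 1) := by unfold gaugeDist; rw [TT.gaugeTransform_one']
    _ ≤ ∑ _e : Edge 3 L, (8 * a + 2 * δu) := Finset.sum_le_sum fun e _ => hlink e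
    _ = Fintype.card (Edge 3 L) * (8 * a + 2 * δu) := by rw [Finset.sum_const, Finset.card_univ, nsmul_eq_mul]

/-- ★★ **`hbo`: the windowed BO function is supported inside the fat tube of the auxiliary record weight.**  If `χ₀ u ≠ 0 ⇒ ‖q(u_k) − 1‖ ≤ δu` (`δu ≥ 0`), `Ω x ≠ 0 ⇒ ‖x‖ ≤ a`
(`0 ≤ a ≤ 1/8`), `|E|·(8a + 2δu) < K·β^{-s}` and `8a + 2δu < M·K·β^{-s}`, then `boFun χ₀ Ω U ≠ 0 → recordChi L s K M β U ≠ 0`. [folklore] -/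
theorem boFun_support_recordChi {s K M β : ℝ} {χ₀ : GaugeConfig 3 1 SU2 → ℝ} {Ω : LinkSpace L → ℝ} {a δu : ℝ} (ha0 : 0 ≤ a) (ha : a ≤ 1 / 8)
    (hχ : ∀ u, χ₀ u ≠ 0 → ∀ k : Fin 3, ‖su2Quat (u (0, k)) - 1‖ ≤ δu) (hΩ : ∀ x, Ω x ≠ 0 → ‖x‖ ≤ a)
    (hδ : Fintype.card (Edge 3 L) * (8 * a + 2 * δu) < K * powScale s β) (hρ : 8 * a + 2 * δu < M * (K * powScale s β))
    (U : GaugeConfig 3 L SU2) (hU : boFun L χ₀ Ω U ≠ 0) : recordChi L s K M β U ≠ 0 := by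
  obtain ⟨hUt, hχU, hΩU⟩ := boFun_ne_zero L hU
  obtain ⟨u, v, hv, rfl⟩ := hUt
  rw [slowMean_orthoTube L u hv] at hχU
  rw [relLinkVec_orthoTube L u hv] at hΩU
  have hvn : ∀ e, ‖v e‖ ≤ a := fun e => by
    refine (pi_norm_le_iff_of_nonneg ha0).2 fun c => ?_
    rw [Real.norm_eq_abs]
    have h := hΩ _ hΩU
    -- `|v e c| ≤ ‖linkEmbed v‖`
    have h2 : ‖(linkEmbed L v) (e, c)‖ ^ 2 ≤ ∑ ea, ‖(linkEmbed L v) ea‖ ^ 2 :=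
      Finset.single_le_sum (f := fun ea => ‖(linkEmbed L v) ea‖ ^ 2) (fun ea _ => sq_nonneg _) (Finset.mem_univ (e, c))
    rw [← EuclideanSpace.norm_sq_eq, linkEmbed_apply, Real.norm_eq_abs] at h2
    have h3 : |v e c| ≤ ‖linkEmbed L v‖ := (pow_le_pow_iff_left₀ (abs_nonneg _) (norm_nonneg _) two_ne_zero).1 h2
    exact h3.trans h
  obtain ⟨hlink, horb⟩ := orthoTube_near_data (L := L) ha hvn (hχ u hχU)
  have hfat : orthoTube L u v ∈ fatTubeRho L (fun b' => K * powScale s b') (fun b' => M * (K * powScale s b')) β :=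
    ⟨fun e => lt_of_le_of_lt (hlink e) hρ, lt_of_le_of_lt horb hδ⟩
  show recordWeightRho L (fun b' => K * powScale s b') (fun b' => M * (K * powScale s b')) (powScale 1) β (orthoTube L u v) ≠ 0
  unfold recordWeightRho
  rw [Set.indicator_of_mem hfat, one_mul]
  exact (Real.exp_pos _).ne'

end Summit.QuantumFields.YangMills.Theorems.FemtoTransferGap.TwoLattice.ConstTube

end
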